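import Mathlib
import Summits.Ventures.PercRepro2.Defs
import Summits.Ventures.PercRepro2.Independence
import Summits.Ventures.PercRepro2.Harris
import Summits.Ventures.PercRepro2.Graph
import Summits.Ventures.PercRepro2.Exploration
import Summits.Ventures.PercRepro2.Events
import Summits.Ventures.PercRepro2.FourFunctions
import Summits.Ventures.PercRepro2.Induced
import Summits.Ventures.PercRepro2.Frontier
import Summits.Ventures.PercRepro2.ObsIndependence
import Summits.Ventures.PercRepro2.BHK
import Summits.Ventures.PercRepro2.BHKEvents
import Summits.Ventures.PercRepro2.VdBKahn
import Summits.Ventures.PercRepro2.BHKAvoid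
import Summits.Ventures.PercRepro2.OrderPreservation
import Summits.Ventures.PercRepro2.OrderPreservationDual
import Summits.Ventures.PercRepro2.R2PrimeThreeReduction
import Summits.Ventures.PercRepro2.YBridge
import Summits.Ventures.PercRepro2.Yu1Functionals
import Summits.Ventures.PercRepro2.Yu1Events
import Summits.Ventures.PercRepro2.Yu1
import Summits.Ventures.PercRepro2.LBSplit
import Summits.Ventures.PercRepro2.YDelta
import Summits.Ventures.PercRepro2.SD
import Summits.Ventures.PercRepro2.Threshold
import Summits.Ventures.PercRepro2.Lambda
import Summits.Ventures.PercRepro2.LambdaTau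
import Summits.Ventures.PercRepro2.LambdaSlack
import Summits.Ventures.PercRepro2.HF2
import Summits.Ventures.PercRepro2.Yu2
import Summits.Ventures.PercRepro2.N0
import Summits.Ventures.PercRepro2.Y
import Summits.Ventures.PercRepro2.YDeltaTools
import Summits.Ventures.PercRepro2.ZDelta
import Summits.Ventures.PercRepro2.ZExpand
import Summits.Ventures.PercRepro2.ISplit
import Summits.Ventures.PercRepro2.MRl
import Summits.Ventures.PercRepro2.ZOloc

/-!
# The three-world anatomy of `Z` (blind cell PercRepro2, typer-1; lead g8 `LEAD-PROOFSHAPES.md`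
§8.9 ADDENDUM 18 (1)–(3), lead g9 ask 2026-08-23T03:25:54Z (a))

Worlds on `Q = {a₁ ↮ a₂}`: `PD = {a₃ ∉ C₁ ∪ C₂}`, `T = {a₃ ∈ C₂}` (`TEvent a₁ a₂ a₃`),
`T′ = {a₃ ∈ C₁}` (`TEvent a₂ a₁ a₃`); `R = PD ⊔ T`, `R_h = PD ⊔ T′`.  With `D = P(PD)`,
`D_l = P(PD, o ∈ C₁)`, `D_h = P(PD, o ∈ C₂)`, `D_o = D_l + D_h`, `W = M₂ + Δ_T`:

* **theorem slacks** `Yu1Slack := D_l · W − D · T_{l→h}` (`≥ 0` under the labelling: `yu1_cleared`)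
  and `Yu2Slack := D_h · W − D · T_{h→l}` (`= ZExpand.Yh`, `≥ 0`: `yu2_cleared`);
* `deltaToL` — `Δ_T^{oL} := P(T, oL, bH) − P(T, oL, bL) = −Δ_l`; **`Aterm`** — `A := Δ_T^{oL} − Δ_h`,
  **antisymmetric under `o ↔ a₃`** (`Aterm_swap`: `A(a₃, o) = −A(o, a₃)`), carrying no PD-world mass;
* **`Z_eq_Yu1_add_Yu2_sub`**: `Z = (Yu1) + (Yu2) − D · A` — the crux says the two PD-world theorem
  slacks pay the T/T′-world preference of `b` for `a₃`'s root over `o`'s root;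
* the four-piece identity **`Z_four_piece`**: `Z = ZPD + TL + D_h · Δ_T + D · Δ_h` in the tree's names
  `ZPD = ZExpand.Z0`, `TL = ZExpand.ZhPrime`, `ZPDl = ZExpand.Z0a`, `ZPDh` (new), `Z_l = D Δ_h`;
  `(Yu1Δ)-slack = ZPDl + TL` (`ZExpand.sigma_light_eq`), `(Yu2Δ)-slack = ZPDh + D_h Δ_T + D Δ_h`
  (`Yu2Delta_slack_eq_pieces`);
* the o-tilt form (ADDENDUM 18 (3)), cleared: **`Z_eq_YuDeltaRoots_add_Gamma`**
  `Z = (YuΔ)_roots + D · Γ_h` with `Γ_h = ZOloc.MQoH = P(Q, oH, bH) − P(Q, oH, bL)` and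
  `(YuΔ)_roots := D_o · W − D · E[1{o ∈ roots} φ_l; Q]` (`YuDeltaRoots`, `= (Yu1Δ)-slack + (Yu1Δ)^{oH}`,
  `YuDeltaRoots_eq`); **`Gamma_nonneg_of_order`**: `Γ_h ≥ 0` under the labelling (R10 with the
  increasing event `{o ∈ C₂}` at the heavy root: `orderPreserving_conn`).

Identities and the two R10/(Yu) theorems only; `(YuΔ)_roots ≥ 0` is FALSE (6,315 / 8,734 at n = 5,
ADDENDUM 18 (3)) and is not typed as a row.
-/

namespace Summit.Ventures.PercRepro2

open UnionCluster Yu1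

namespace ZAnatomy

section Defs

variable {V : Type*} {E : Type*} [Fintype E] [DecidableEq E] [DecidableEq V] {R : Type*} [Field R]

/-- `(Yu1) := D_l · W − D · T_{l→h}` — the slack of the theorem (Yu1) (`yu1_cleared`). -/
noncomputable def Yu1Slack (p : E → R) (ends : E → Sym2 V) (o a₁ a₂ a₃ b : V) : R :=
  prob p (PDEvent ends a₁ a₂ a₃ ∩ connEvent ends a₁ o) *
      (massM2 p ends a₁ a₂ a₃ b + deltaT p ends a₁ a₂ a₃ b) -
    prob p (PDEvent ends a₁ a₂ a₃) *
      prob p (PDEvent ends a₁ a₂ a₃ ∩ connEvent ends a₁ o ∩ connEvent ends a₂ b)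

/-- `(Yu2) := D_h · W − D · T_{h→l}` — the slack of the theorem (Yu2) (`yu2_cleared`; `= ZExpand.Yh`). -/
noncomputable def Yu2Slack (p : E → R) (ends : E → Sym2 V) (o a₁ a₂ a₃ b : V) : R :=
  prob p (PDEvent ends a₁ a₂ a₃ ∩ connEvent ends a₂ o) *
      (massM2 p ends a₁ a₂ a₃ b + deltaT p ends a₁ a₂ a₃ b) -
    prob p (PDEvent ends a₁ a₂ a₃) *
      prob p (PDEvent ends a₁ a₂ a₃ ∩ connEvent ends a₂ o ∩ connEvent ends a₁ b)

/-- `Δ_T^{oL} := P(T, o ∈ C₁, b ∈ C₂) − P(T, o ∈ C₁, b ∈ C₁)` (`= −Δ_l`). -/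
noncomputable def deltaToL (p : E → R) (ends : E → Sym2 V) (o a₁ a₂ a₃ b : V) : R :=
  prob p (TEvent ends a₁ a₂ a₃ ∩ connEvent ends a₁ o ∩ connEvent ends a₂ b) -
    prob p (TEvent ends a₁ a₂ a₃ ∩ connEvent ends a₁ o ∩ connEvent ends a₁ b)

/-- **`A := Δ_T^{oL} − Δ_h`** `= P(Q, o ⊥ a₃, b with a₃) − P(Q, o ⊥ a₃, b with o)` (`o ⊥ a₃` = `o` and
`a₃` in different root clusters): antisymmetric under `o ↔ a₃` (`Aterm_swap`). -/
noncomputable def Aterm (p : E → R) (ends : E → Sym2 V) (o a₁ a₂ a₃ b : V) : R :=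
  deltaToL p ends o a₁ a₂ a₃ b - deltaH p ends o a₁ a₂ a₃ b

/-- `ZPDh := D_h · M₂ − D · T_{h→l}` (the heavy half of the PD-world piece `ZPD = Z0 = Z0a + ZPDh`). -/
noncomputable def ZPDh (p : E → R) (ends : E → Sym2 V) (o a₁ a₂ a₃ b : V) : R :=
  prob p (PDEvent ends a₁ a₂ a₃ ∩ connEvent ends a₂ o) * massM2 p ends a₁ a₂ a₃ b -
    prob p (PDEvent ends a₁ a₂ a₃) *
      prob p (PDEvent ends a₁ a₂ a₃ ∩ connEvent ends a₂ o ∩ connEvent ends a₁ b)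

/-- `(Yu1Δ)^{oH} := D_h · W − D · [P(R, oH, bH) − P(T, oH, bL)]` (the `o ∈ C₂` companion of the
(Yu1Δ)-slack `D_l · W − D · [P(R, oL, bH) − P(T, oL, bL)]`). -/
noncomputable def Yu1DeltaOH (p : E → R) (ends : E → Sym2 V) (o a₁ a₂ a₃ b : V) : R :=
  prob p (PDEvent ends a₁ a₂ a₃ ∩ connEvent ends a₂ o) *
      (massM2 p ends a₁ a₂ a₃ b + deltaT p ends a₁ a₂ a₃ b) -
    prob p (PDEvent ends a₁ a₂ a₃) *
      (prob p (avoidAll ends a₁ {a₂, a₃} ∩ connEvent ends a₂ o ∩ connEvent ends a₂ b) -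
        prob p (TEvent ends a₁ a₂ a₃ ∩ connEvent ends a₂ o ∩ connEvent ends a₁ b))

/-- **`(YuΔ)_roots := D_o · W − D · E[1{o ∈ C₁ ∪ C₂} φ_l; Q]`** with
`E[1{o ∈ roots} φ_l; Q] = [P(R, oL, bH) + P(R, oH, bH)] − [P(T, oL, bL) + P(T, oH, bL)]`
(ADDENDUM 18 (3); FALSE as a row). -/
noncomputable def YuDeltaRoots (p : E → R) (ends : E → Sym2 V) (o a₁ a₂ a₃ b : V) : R :=
  (prob p (PDEvent ends a₁ a₂ a₃ ∩ connEvent ends a₁ o) +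
      prob p (PDEvent ends a₁ a₂ a₃ ∩ connEvent ends a₂ o)) *
    (massM2 p ends a₁ a₂ a₃ b + deltaT p ends a₁ a₂ a₃ b) -
  prob p (PDEvent ends a₁ a₂ a₃) *
    ((prob p (avoidAll ends a₁ {a₂, a₃} ∩ connEvent ends a₁ o ∩ connEvent ends a₂ b) +
        prob p (avoidAll ends a₁ {a₂, a₃} ∩ connEvent ends a₂ o ∩ connEvent ends a₂ b)) -
      (prob p (TEvent ends a₁ a₂ a₃ ∩ connEvent ends a₁ o ∩ connEvent ends a₁ b) +
        prob p (TEvent ends a₁ a₂ a₃ ∩ connEvent ends a₂ o ∩ connEvent ends a₁ b)))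

end Defs

section Bookkeeping

variable {V : Type*} {E : Type*} [Fintype E] [DecidableEq E] [Fintype V] [DecidableEq V]
  {R : Type*} [Field R] [LinearOrder R] [IsStrictOrderedRing R]

omit [Fintype V] [DecidableEq V] [LinearOrder R] [IsStrictOrderedRing R] in
/-- `Δ_T^{oL} = −Δ_l`. -/
lemma deltaToL_eq_neg_deltaL (p : E → R) (ends : E → Sym2 V) (o a₁ a₂ a₃ b : V) :
    deltaToL p ends o a₁ a₂ a₃ b = -deltaL p ends o a₁ a₂ a₃ b := by
  unfold deltaToL deltaL
  ring

omit [Fintype V] [DecidableEq V] [LinearOrder R] [IsStrictOrderedRing R] in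
/-- `Yu2Slack = ZExpand.Yh`. -/
lemma Yu2Slack_eq_Yh (p : E → R) (ends : E → Sym2 V) (o a₁ a₂ a₃ b : V) :
    Yu2Slack p ends o a₁ a₂ a₃ b = Yh p ends o a₁ a₂ a₃ b := rfl

omit [Fintype V] [DecidableEq V] [LinearOrder R] [IsStrictOrderedRing R] in
/-- **The three-world anatomy** (ADDENDUM 18 (2)): the (ZΔ)-slack is `Z = (Yu1) + (Yu2) − D · A`. -/
theorem Z_eq_Yu1_add_Yu2_sub (p : E → R) (ends : E → Sym2 V) (o a₁ a₂ a₃ b : V) :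
    (prob p (PDEvent ends a₁ a₂ a₃ ∩ connEvent ends a₁ o) +
          prob p (PDEvent ends a₁ a₂ a₃ ∩ connEvent ends a₂ o)) *
        (massM2 p ends a₁ a₂ a₃ b + deltaT p ends a₁ a₂ a₃ b) -
      ((prob p (PDEvent ends a₁ a₂ a₃ ∩ connEvent ends a₁ o ∩ connEvent ends a₂ b) -
            deltaL p ends o a₁ a₂ a₃ b) +
          (prob p (PDEvent ends a₁ a₂ a₃ ∩ connEvent ends a₂ o ∩ connEvent ends a₁ b) -
            deltaH p ends o a₁ a₂ a₃ b)) * prob p (PDEvent ends a₁ a₂ a₃) =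
      Yu1Slack p ends o a₁ a₂ a₃ b + Yu2Slack p ends o a₁ a₂ a₃ b -
        prob p (PDEvent ends a₁ a₂ a₃) * Aterm p ends o a₁ a₂ a₃ b := by
  unfold Yu1Slack Yu2Slack Aterm deltaToL deltaL
  ring

omit [Fintype V] [DecidableEq V] [LinearOrder R] [IsStrictOrderedRing R] in
/-- **The four-piece identity** (ADDENDUM 18 (1)): `Z = ZPD + TL + D_h · Δ_T + D · Δ_h` with
`ZPD = Z0`, `TL = ZhPrime`. -/
theorem Z_four_piece (p : E → R) (ends : E → Sym2 V) (o a₁ a₂ a₃ b : V) :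
    (prob p (PDEvent ends a₁ a₂ a₃ ∩ connEvent ends a₁ o) +
          prob p (PDEvent ends a₁ a₂ a₃ ∩ connEvent ends a₂ o)) *
        (massM2 p ends a₁ a₂ a₃ b + deltaT p ends a₁ a₂ a₃ b) -
      ((prob p (PDEvent ends a₁ a₂ a₃ ∩ connEvent ends a₁ o ∩ connEvent ends a₂ b) -
            deltaL p ends o a₁ a₂ a₃ b) +
          (prob p (PDEvent ends a₁ a₂ a₃ ∩ connEvent ends a₂ o ∩ connEvent ends a₁ b) -
            deltaH p ends o a₁ a₂ a₃ b)) * prob p (PDEvent ends a₁ a₂ a₃) =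
      Z0 p ends o a₁ a₂ a₃ b + ZhPrime p ends o a₁ a₂ a₃ b +
        prob p (PDEvent ends a₁ a₂ a₃ ∩ connEvent ends a₂ o) * deltaT p ends a₁ a₂ a₃ b +
        prob p (PDEvent ends a₁ a₂ a₃) * deltaH p ends o a₁ a₂ a₃ b := by
  unfold Z0 ZhPrime deltaL
  ring

omit [Fintype V] [DecidableEq V] [LinearOrder R] [IsStrictOrderedRing R] in
/-- `ZPD = Z0 = Z0a + ZPDh` (`ZPDl = Z0a`). -/
lemma Z0_eq_Z0a_add_ZPDh (p : E → R) (ends : E → Sym2 V) (o a₁ a₂ a₃ b : V) :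
    Z0 p ends o a₁ a₂ a₃ b = Z0a p ends o a₁ a₂ a₃ b + ZPDh p ends o a₁ a₂ a₃ b := by
  unfold Z0 Z0a ZPDh
  ring

omit [Fintype V] [DecidableEq V] [LinearOrder R] [IsStrictOrderedRing R] in
/-- `(Yu2Δ)-slack = ZPDh + D_h · Δ_T + D · Δ_h` (the mirror of `sigma_light_eq`). -/
theorem Yu2Delta_slack_eq_pieces (p : E → R) (ends : E → Sym2 V) (o a₁ a₂ a₃ b : V) :
    prob p (PDEvent ends a₁ a₂ a₃ ∩ connEvent ends a₂ o) *
          (massM2 p ends a₁ a₂ a₃ b + deltaT p ends a₁ a₂ a₃ b) +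
        deltaH p ends o a₁ a₂ a₃ b * prob p (PDEvent ends a₁ a₂ a₃) -
      prob p (PDEvent ends a₁ a₂ a₃ ∩ connEvent ends a₂ o ∩ connEvent ends a₁ b) *
        prob p (PDEvent ends a₁ a₂ a₃) =
      ZPDh p ends o a₁ a₂ a₃ b +
        prob p (PDEvent ends a₁ a₂ a₃ ∩ connEvent ends a₂ o) * deltaT p ends a₁ a₂ a₃ b +
        prob p (PDEvent ends a₁ a₂ a₃) * deltaH p ends o a₁ a₂ a₃ b := by
  unfold ZPDh
  ring

/-- `(Yu1) ≥ 0` under the labelling (`yu1_cleared`). -/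
theorem Yu1Slack_nonneg_of_order (p : E → R) (hp : IsProbVec p) (ends : E → Sym2 V)
    {o a₁ a₂ a₃ b : V}
    (hord : prob p (connEvent ends a₁ b) ≤ prob p (connEvent ends a₂ b)) :
    0 ≤ Yu1Slack p ends o a₁ a₂ a₃ b := by
  unfold Yu1Slack
  have := yu1_cleared p hp ends (o := o) (a₃ := a₃) hord
  linarith

/-- `(Yu2) ≥ 0` under the labelling (`yu2_cleared`). -/
theorem Yu2Slack_nonneg_of_order (p : E → R) (hp : IsProbVec p) (ends : E → Sym2 V)
    {o a₁ a₂ a₃ b : V}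
    (hord : prob p (connEvent ends a₁ b) ≤ prob p (connEvent ends a₂ b)) :
    0 ≤ Yu2Slack p ends o a₁ a₂ a₃ b := by
  rw [Yu2Slack_eq_Yh]
  exact Yh_nonneg_of_order p hp ends hord

end Bookkeeping

section Antisymmetry

variable {V : Type*} {E : Type*} [Fintype E] [DecidableEq E] [Fintype V] [DecidableEq V]
  {R : Type*} [Field R] [LinearOrder R] [IsStrictOrderedRing R]

omit [Fintype E] [DecidableEq E] [Fintype V] [DecidableEq V] in
/-- `{y ∉ C_x, u ∈ C_y, v ∈ C_x} = {x ∉ C_y, v ∈ C_x, u ∈ C_y}` (with a further factor `X`). -/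
lemma T_conn_swap_eq (ends : E → Sym2 V) (x y u v : V) (X : Set (Config E)) :
    TEvent ends x y u ∩ connEvent ends x v ∩ X = TEvent ends y x v ∩ connEvent ends y u ∩ X := by
  ext ω
  simp only [TEvent, Set.mem_inter_iff, Set.mem_compl_iff, mem_connEvent]
  have h12 : Conn ends ω y x ↔ Conn ends ω x y := ⟨conn_symm, conn_symm⟩
  tauto

omit [Fintype V] [DecidableEq V] [LinearOrder R] [IsStrictOrderedRing R] in
/-- `Δ_T^{oL}` with `o ↔ a₃` swapped is `Δ_h`. -/
lemma deltaToL_swap (p : E → R) (ends : E → Sym2 V) (o a₁ a₂ a₃ b : V) :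
    deltaToL p ends a₃ a₁ a₂ o b = deltaH p ends o a₁ a₂ a₃ b := by
  unfold deltaToL deltaH
  rw [T_conn_swap_eq ends a₁ a₂ o a₃ (connEvent ends a₂ b),
    T_conn_swap_eq ends a₁ a₂ o a₃ (connEvent ends a₁ b)]

omit [Fintype V] [DecidableEq V] [LinearOrder R] [IsStrictOrderedRing R] in
/-- `Δ_h` with `o ↔ a₃` swapped is `Δ_T^{oL}`. -/
lemma deltaH_swap (p : E → R) (ends : E → Sym2 V) (o a₁ a₂ a₃ b : V) :
    deltaH p ends a₃ a₁ a₂ o b = deltaToL p ends o a₁ a₂ a₃ b := by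
  unfold deltaToL deltaH
  rw [T_conn_swap_eq ends a₂ a₁ o a₃ (connEvent ends a₂ b),
    T_conn_swap_eq ends a₂ a₁ o a₃ (connEvent ends a₁ b)]

omit [Fintype V] [DecidableEq V] [LinearOrder R] [IsStrictOrderedRing R] in
/-- **`A` is antisymmetric under `o ↔ a₃`**: `A(a₃, o) = −A(o, a₃)`. -/
theorem Aterm_swap (p : E → R) (ends : E → Sym2 V) (o a₁ a₂ a₃ b : V) :
    Aterm p ends a₃ a₁ a₂ o b = -Aterm p ends o a₁ a₂ a₃ b := by
  unfold Aterm
  rw [deltaToL_swap p ends o a₁ a₂ a₃ b, deltaH_swap p ends o a₁ a₂ a₃ b]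
  ring

end Antisymmetry

section OTilt

variable {V : Type*} {E : Type*} [Fintype E] [DecidableEq E] [Fintype V] [DecidableEq V]
  {R : Type*} [Field R] [LinearOrder R] [IsStrictOrderedRing R]

omit [Fintype V] [LinearOrder R] [IsStrictOrderedRing R] in
/-- `(YuΔ)_roots = (Yu1Δ)-slack + (Yu1Δ)^{oH}`. -/
theorem YuDeltaRoots_eq (p : E → R) (ends : E → Sym2 V) (o a₁ a₂ a₃ b : V) :
    YuDeltaRoots p ends o a₁ a₂ a₃ b =
      (prob p (PDEvent ends a₁ a₂ a₃ ∩ connEvent ends a₁ o) *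
            (massM2 p ends a₁ a₂ a₃ b + deltaT p ends a₁ a₂ a₃ b) +
          deltaL p ends o a₁ a₂ a₃ b * prob p (PDEvent ends a₁ a₂ a₃) -
        prob p (PDEvent ends a₁ a₂ a₃ ∩ connEvent ends a₁ o ∩ connEvent ends a₂ b) *
          prob p (PDEvent ends a₁ a₂ a₃)) +
      Yu1DeltaOH p ends o a₁ a₂ a₃ b := by
  have h := Tlh_sub_deltaL p ends o a₁ a₂ a₃ b
  have e1 : connEvent ends a₁ o ∩ connEvent ends a₂ b ∩ avoidAll ends a₁ {a₂, a₃} =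
      avoidAll ends a₁ {a₂, a₃} ∩ connEvent ends a₁ o ∩ connEvent ends a₂ b := by
    ext ω; simp only [Set.mem_inter_iff]; tauto
  have e2 : connEvent ends a₁ o ∩ connEvent ends a₁ b ∩ TEvent ends a₁ a₂ a₃ =
      TEvent ends a₁ a₂ a₃ ∩ connEvent ends a₁ o ∩ connEvent ends a₁ b := by
    ext ω; simp only [Set.mem_inter_iff]; tauto
  rw [e1, e2] at h
  unfold YuDeltaRoots Yu1DeltaOH
  linear_combination (prob p (PDEvent ends a₁ a₂ a₃)) * h

omit [Fintype V] [LinearOrder R] [IsStrictOrderedRing R] in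
/-- **The o-tilt form, cleared** (ADDENDUM 18 (3)): `Z = (YuΔ)_roots + D · Γ_h`, `Γ_h = M_Q^{oH}`. -/
theorem Z_eq_YuDeltaRoots_add_Gamma (p : E → R) (ends : E → Sym2 V) (o a₁ a₂ a₃ b : V) :
    (prob p (PDEvent ends a₁ a₂ a₃ ∩ connEvent ends a₁ o) +
          prob p (PDEvent ends a₁ a₂ a₃ ∩ connEvent ends a₂ o)) *
        (massM2 p ends a₁ a₂ a₃ b + deltaT p ends a₁ a₂ a₃ b) -
      ((prob p (PDEvent ends a₁ a₂ a₃ ∩ connEvent ends a₁ o ∩ connEvent ends a₂ b) -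
            deltaL p ends o a₁ a₂ a₃ b) +
          (prob p (PDEvent ends a₁ a₂ a₃ ∩ connEvent ends a₂ o ∩ connEvent ends a₁ b) -
            deltaH p ends o a₁ a₂ a₃ b)) * prob p (PDEvent ends a₁ a₂ a₃) =
      YuDeltaRoots p ends o a₁ a₂ a₃ b +
        prob p (PDEvent ends a₁ a₂ a₃) * ZOloc.MQoH p ends o a₁ a₂ b := by
  have hZ := ZOloc.Z_oloc_identity p ends o a₁ a₂ a₃ b
  have hW := ZOloc.W_sub_Wout p ends o a₁ a₂ a₃ b
  have hD := ISplit.D_split p ends o a₁ a₂ a₃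
  unfold YuDeltaRoots
  linear_combination hZ - (prob p (PDEvent ends a₁ a₂ a₃)) * hW +
    (massM2 p ends a₁ a₂ a₃ b + deltaT p ends a₁ a₂ a₃ b) * hD

omit [Fintype E] [DecidableEq E] [Fintype V] [DecidableEq V] in
/-- `Q = {a₂ ↮ a₁}` as a complement. -/
lemma avoidAll_single_eq (ends : E → Sym2 V) (a₂ a₁ : V) :
    avoidAll ends a₂ {a₁} = (connEvent ends a₂ a₁)ᶜ := by
  ext ω
  simp only [mem_avoidAll, Finset.mem_singleton, forall_eq, Set.mem_compl_iff, mem_connEvent]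

omit [Fintype E] [DecidableEq E] [Fintype V] [DecidableEq V] in
/-- On `{a₂ ↔ a₁}` the events `{b ∈ C₁}` and `{b ∈ C₂}` coincide (with a further factor `A`). -/
lemma conn_swap_on_joined (ends : E → Sym2 V) (a₁ a₂ b : V) (A : Set (Config E)) :
    A ∩ connEvent ends a₁ b ∩ connEvent ends a₂ a₁ = A ∩ connEvent ends a₂ b ∩ connEvent ends a₂ a₁ := by
  ext ω
  simp only [Set.mem_inter_iff, mem_connEvent]
  exact ⟨fun ⟨⟨h1, h2⟩, h3⟩ => ⟨⟨h1, conn_trans h3 h2⟩, h3⟩,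
    fun ⟨⟨h1, h2⟩, h3⟩ => ⟨⟨h1, conn_trans (conn_symm h3) h2⟩, h3⟩⟩

/-- **`Γ_h ≥ 0` under the labelling** — R10 (`orderPreserving_conn`) with the increasing event
`{o ∈ C₂}` at the heavy root; the `{a₁ ↔ a₂}` parts of the two sides cancel. -/
theorem Gamma_nonneg_of_order (p : E → R) (hp : IsProbVec p) (ends : E → Sym2 V) {o a₁ a₂ b : V}
    (hord : prob p (connEvent ends a₁ b) ≤ prob p (connEvent ends a₂ b)) :
    0 ≤ ZOloc.MQoH p ends o a₁ a₂ b := by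
  have h10 := orderPreserving_conn p hp ends a₂ a₁ b (isUpperSet_mem_setOf o) hord
  rw [← connEvent_eq_clusterInEvent] at h10
  have s1 := prob_inter_add_prob_inter_compl p (connEvent ends a₂ o ∩ connEvent ends a₁ b)
    (connEvent ends a₂ a₁)
  have s2 := prob_inter_add_prob_inter_compl p (connEvent ends a₂ o ∩ connEvent ends a₂ b)
    (connEvent ends a₂ a₁)
  rw [conn_swap_on_joined] at s1
  unfold ZOloc.MQoH
  rw [avoidAll_single_eq]
  have e1 : (connEvent ends a₂ a₁)ᶜ ∩ connEvent ends a₂ o ∩ connEvent ends a₂ b =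
      connEvent ends a₂ o ∩ connEvent ends a₂ b ∩ (connEvent ends a₂ a₁)ᶜ := by
    ext ω; simp only [Set.mem_inter_iff]; tauto
  have e2 : (connEvent ends a₂ a₁)ᶜ ∩ connEvent ends a₂ o ∩ connEvent ends a₁ b =
      connEvent ends a₂ o ∩ connEvent ends a₁ b ∩ (connEvent ends a₂ a₁)ᶜ := by
    ext ω; simp only [Set.mem_inter_iff]; tauto
  rw [e1, e2]
  linarith

end OTilt

end ZAnatomy

end Summit.Ventures.PercRepro2
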